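import Literature.AnabelianGeometry.SemiGraphs.PSCSeparatingCoverings
import Literature.AnabelianGeometry.SemiGraphs.CommensurableTerminalityLemmas

/-!
# [CombGC] Proposition 1.2 from the separating coverings, I: row P12-L02 (Prop. 1.2 (i), level-wise), PROVED

Mochizuki, *A combinatorial version of the Grothendieck conjecture*, Tohoku Math. J. **59** (2007)
[CombGC], Prop. 1.2 pp. 8–9 [cite: MochizukiCombGC2007, Prop 1.2 pp.8-9].  PROOF-ONLY companion
(abc-iut-w5-d183, L3-lead ruling γ3-3) of abc-iut-w4-d081's statements file `PSCSeparatingCoverings.lean`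
(sub-DAG `plan/L3/SUBDAG-CombGC-Prop12.md`, row P12-L01 `PSCDatum.SeparatingCoverings` = print p. 9:
"there exists a finite étale `Π^unr_G`- (respectively, `Π_G`-) covering `G′ → G` whose restriction to the
anabelioid `G_{v₂}` (respectively, `G_{e₂}`) is trivial […], but whose restriction to the anabelioid
`G_{v₁}` (respectively, `G_{e₁}`) is nontrivial", typed level-wise over one `PSCDatum`).  The steps print
calls formal ARE formalised here over abc-iut-L3-t4's interface `PSCDatum Π` for PROFINITE `Π`
(`[CompactSpace Π] [TotallyDisconnectedSpace Π]`; Def. 1.1 (ii): "the maximal pro-Σ quotient of the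
profinite fundamental group"):

* **P12-L02** (`verticialOpenInterDeterminesVertex_of_separating`, `edgeLikeOpenInterDeterminesEdge_of_separating`,
  `unrVerticialOpenInterDeterminesVertex_of_separating`): Prop. 1.2 (i) — in fact (i) AT EVERY LEVEL
  (`sameVertex_of_isOpen`, `sameEdge_of_isOpen`, `sameVertex_of_isOpen_unr`: two vertices of a finite
  étale Galois covering `G_U` whose decomposition groups meet openly are the same vertex), via "possibly
  replacing `G` by some finite étale covering of `G` [which allows us, in particular, to replace the words
  “open in” in assertion (i) by the words “equal to”]" (`exists_openNormal_inf_le`);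
* the abstract core of **P12-L03** (`commensurator_eq_of_levelwise`: "(ii) follows formally from (i)" —
  `γ ∈ C_Π(A)` ⇒ `A ∩ γAγ⁻¹` closed of finite index, hence open, in `A` ⇒ level-wise (i) ⇒
  `γ ∈ ⋂_U U·A = A`); rows P12-L03 / P12-L00 are closed in the sequel `PSCSeparatingCoveringsProofs2.lean`.

Pure group theory / topology (Mathlib `ProfiniteGrp.exist_openNormalSubgroup_sub_open_nhds_of_one`,
`Subgroup.isOpen_of_isClosed_of_finiteIndex`; the tree's `exists_openNormalSubgroup_forall_mul_ne`,
`le_commensurator_self`); NO definition, nothing of [CombGC] asserted; nothing here takes a side on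
[IUTchIII] Cor. 3.12.
-/


noncomputable section

namespace Literature.AnabelianGeometry.SemiGraphs

namespace PSCDatum

open scoped Pointwise

universe u

variable {P : Type u} [Group P] [TopologicalSpace P]

/-! ## 0. Relative openness: bookkeeping -/

omit [TopologicalSpace P] in
/-- The carrier of `(A₁ ⊓ A₂).subgroupOf A₁` (the shape of "`A₁ ∩ A₂` is open in `A₁`" in
`PSCGraphicity.lean`) is the preimage of `A₂` in `A₁`. [folklore] -/
private theorem coe_inf_subgroupOf (A₁ A₂ : Subgroup P) :
    (((A₁ ⊓ A₂).subgroupOf A₁ : Subgroup A₁) : Set A₁) = ((↑) : A₁ → P) ⁻¹' (A₂ : Set P) := by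
  ext x
  simp only [SetLike.mem_coe, Subgroup.mem_subgroupOf, Subgroup.mem_inf, Set.mem_preimage,
    and_iff_right x.2]

/-- "`A₁ ∩ A₂` open in `A₁`" yields an open `W ∋ 1` of `Π` with `W ∩ A₁ ⊆ A₂`. [folklore] -/
private theorem exists_isOpen_of_isOpen_preimage {A₁ A₂ : Subgroup P}
    (h : IsOpen (((↑) : A₁ → P) ⁻¹' (A₂ : Set P))) :
    ∃ W : Set P, IsOpen W ∧ (1 : P) ∈ W ∧ W ∩ (A₁ : Set P) ⊆ A₂ := by
  rw [isOpen_induced_iff] at h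
  obtain ⟨W, hW, hWA⟩ := h
  refine ⟨W, hW, ?_, ?_⟩
  · have h1 : (⟨1, A₁.one_mem⟩ : A₁) ∈ ((↑) : A₁ → P) ⁻¹' (A₂ : Set P) := A₂.one_mem
    rw [← hWA] at h1
    exact h1
  · rintro x ⟨hxW, hxA⟩
    have hx : (⟨x, hxA⟩ : A₁) ∈ ((↑) : A₁ → P) ⁻¹' W := hxW
    rw [hWA] at hx
    exact hx

/-- Relative openness passes to the intersections with any further subgroup `U`. [folklore] -/
private theorem isOpen_preimage_inf {A₁ A₂ : Subgroup P} (h : IsOpen (((↑) : A₁ → P) ⁻¹' (A₂ : Set P)))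
    (U : Subgroup P) : IsOpen (((↑) : ↥(U ⊓ A₁) → P) ⁻¹' (A₂ : Set P)) := by
  have hcont : Continuous (Subgroup.inclusion (inf_le_right : U ⊓ A₁ ≤ A₁)) :=
    continuous_induced_rng.2 continuous_subtype_val
  have heq : ((↑) : ↥(U ⊓ A₁) → P) ⁻¹' (A₂ : Set P) =
      Subgroup.inclusion (inf_le_right : U ⊓ A₁ ≤ A₁) ⁻¹' (((↑) : A₁ → P) ⁻¹' (A₂ : Set P)) := by
    ext x
    simp only [Set.mem_preimage, SetLike.mem_coe, Subgroup.coe_inclusion]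
  rw [heq]
  exact h.preimage hcont

omit [TopologicalSpace P] in
/-- Transport of relative openness along an equality of the ambient subgroup. [folklore] -/
private theorem isOpen_preimage_of_eq [TopologicalSpace P] {A B : Subgroup P} (hAB : A = B) {S : Set P}
    (h : IsOpen (((↑) : A → P) ⁻¹' S)) : IsOpen (((↑) : B → P) ⁻¹' S) := by
  subst hAB
  exact h

/-- A closed subgroup of finite relative index is relatively open: if `A₂.relIndex A₁ ≠ 0` and `A₂` is
closed, then `A₁ ∩ A₂` is open in `A₁` (a closed subgroup of finite index is open). [folklore] -/
private theorem isOpen_preimage_of_relIndex_ne_zero [IsTopologicalGroup P] {A₁ A₂ : Subgroup P}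
    (h₂ : IsClosed (A₂ : Set P)) (hidx : A₂.relIndex A₁ ≠ 0) :
    IsOpen (((↑) : A₁ → P) ⁻¹' (A₂ : Set P)) := by
  haveI : (A₂.subgroupOf A₁).FiniteIndex := ⟨hidx⟩
  have hcl : IsClosed ((A₂.subgroupOf A₁ : Subgroup A₁) : Set A₁) := h₂.preimage continuous_subtype_val
  exact Subgroup.isOpen_of_isClosed_of_finiteIndex _ hcl

/-- A conjugate of a closed subgroup is closed (Def. 1.1 (ii), p. 6: "A vertex (respectively, edge) of `𝔾`
determines, up to conjugation, a closed subgroup of `Π_G`"). [cite: MochizukiCombGC2007, Def 1.1(ii) p.6] -/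
theorem isClosed_conj_smul [IsTopologicalGroup P] {A : Subgroup P} (hA : IsClosed (A : Set P))
    (γ : ConjAct P) : IsClosed ((γ • A : Subgroup P) : Set P) := by
  have h : ((γ • A : Subgroup P) : Set P) = (fun x : P => γ⁻¹ • x) ⁻¹' (A : Set P) := by
    ext x
    rw [SetLike.mem_coe, Subgroup.mem_pointwise_smul_iff_inv_smul_mem]
    rfl
  rw [h]
  refine hA.preimage ?_
  simp only [ConjAct.smul_def]
  fun_prop

omit [TopologicalSpace P] in
/-- Double cosets only grow with the middle group. [folklore] -/
private theorem doubleCoset_mono {U U' : Subgroup P} (hUU' : U' ≤ U) (γ : P) (A : Set P) :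
    DoubleCoset.doubleCoset γ (U' : Set P) A ⊆ DoubleCoset.doubleCoset γ (U : Set P) A :=
  Set.mul_subset_mul_right (Set.mul_subset_mul_right (SetLike.coe_subset_coe.mpr hUU'))

/-! ## 1. Profinite groups: "open in" ⇒ "equal to" at a smaller level; `⋂_U U·A = A` -/

section Profinite

variable [IsTopologicalGroup P] [CompactSpace P] [TotallyDisconnectedSpace P]

/-- **P12-L02, the shrinking step** ("[which allows us, in particular, to replace the words “open in” in
assertion (i) by the words “equal to”]", p. 9): in a profinite group, if `A₁ ∩ A₂` is open in `A₁` then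
`U ∩ A₁ ≤ A₂` for some open normal `U`, which may be taken to contain any normal `K ≤ A₁ ∩ A₂` (take
`U = N·K` for an open normal `N` inside an open `W ∋ 1` with `W ∩ A₁ ⊆ A₂`; `K = Ker(Π_G ↠ Π^unr_G)`
for the unramified clause, where the level must remain a `Π^unr_G`-covering).
[cite: MochizukiCombGC2007, Prop 1.2 p.9] -/
theorem exists_openNormal_inf_le {A₁ A₂ K : Subgroup P} [K.Normal] (hK₁ : K ≤ A₁) (hK₂ : K ≤ A₂)
    (h : IsOpen (((↑) : A₁ → P) ⁻¹' (A₂ : Set P))) :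
    ∃ U : Subgroup P, IsOpen (U : Set P) ∧ U.Normal ∧ K ≤ U ∧ U ⊓ A₁ ≤ A₂ := by
  obtain ⟨W, hWo, h1W, hW⟩ := exists_isOpen_of_isOpen_preimage h
  obtain ⟨N, hN⟩ := ProfiniteGrp.exist_openNormalSubgroup_sub_open_nhds_of_one hWo h1W
  refine ⟨N.toSubgroup ⊔ K, ?_, inferInstance, le_sup_right, ?_⟩
  · exact Subgroup.isOpen_mono le_sup_left N.isOpen
  · intro x hx
    obtain ⟨hxU, hxA⟩ := Subgroup.mem_inf.mp hx
    have hx' : (x : P) ∈ ((N.toSubgroup ⊔ K : Subgroup P) : Set P) := hxU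
    rw [Subgroup.normal_mul] at hx'
    obtain ⟨n, hn, k, hk, rfl⟩ := Set.mem_mul.mp hx'
    have hnA : n ∈ A₁ := by simpa using A₁.mul_mem hxA (A₁.inv_mem (hK₁ hk))
    exact A₂.mul_mem (hW ⟨hN hn, hnA⟩) (hK₂ hk)

/-- In a profinite group, `⋂_U U·A = A` over the open normal `U` containing a normal `K ≤ A` (`A` closed):
the last step of the derivation of (ii) from (i). [cite: MochizukiCombGC2007, Prop 1.2 p.9] -/
theorem mem_of_forall_mem_mul {A K : Subgroup P} (hA : IsClosed (A : Set P)) [K.Normal] (hKA : K ≤ A)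
    {g : P} (h : ∀ U : Subgroup P, IsOpen (U : Set P) → U.Normal → K ≤ U → g ∈ (U : Set P) * (A : Set P)) :
    g ∈ A := by
  haveI : T2Space P := inferInstance
  by_contra hg
  obtain ⟨N, hN⟩ := exists_openNormalSubgroup_forall_mul_ne A hA hg
  have hmem := h (N.toSubgroup ⊔ K) (Subgroup.isOpen_mono le_sup_left N.isOpen) inferInstance le_sup_right
  obtain ⟨u, hu, a, ha, hg'⟩ := Set.mem_mul.mp hmem
  have hu' : u ∈ ((N.toSubgroup ⊔ K : Subgroup P) : Set P) := hu
  rw [Subgroup.normal_mul] at hu'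
  obtain ⟨n, hn, k, hk, rfl⟩ := Set.mem_mul.mp hu'
  have hka : k * a ∈ A := A.mul_mem (hKA hk) ha
  have hNn : (N.toSubgroup).Normal := inferInstance
  have hconj : (k * a)⁻¹ * n * (k * a) ∈ N := hNn.conj_mem' n hn (k * a)
  refine hN (k * a) hka ((k * a)⁻¹ * n * (k * a)) hconj ?_
  rw [← hg']
  group

/-- **The abstract core of P12-L03** ("(ii) follows formally from (i)"): if, at every open normal level
`U ⊇ K` and for every `g`, relative openness of `(U ∩ A) ∩ gAg⁻¹` in `U ∩ A` forces `g ∈ U·A`, then the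
closed subgroup `A` (containing the normal `K`) is commensurably terminal. [cite: MochizukiCombGC2007, Prop 1.2 p.9] -/
theorem commensurator_eq_of_levelwise {A K : Subgroup P} (hA : IsClosed (A : Set P)) [K.Normal]
    (hKA : K ≤ A)
    (h : ∀ U : Subgroup P, IsOpen (U : Set P) → U.Normal → K ≤ U → ∀ g : P,
      IsOpen (((↑) : ↥(U ⊓ A) → P) ⁻¹' ((ConjAct.toConjAct g • A : Subgroup P) : Set P)) →
        g ∈ (U : Set P) * (A : Set P)) :
    Subgroup.Commensurable.commensurator A = A := by
  refine le_antisymm (fun g hg => ?_) (le_commensurator_self A)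
  rw [Subgroup.Commensurable.commensurator_mem_iff] at hg
  have hrel : IsOpen (((↑) : A → P) ⁻¹' ((ConjAct.toConjAct g • A : Subgroup P) : Set P)) :=
    isOpen_preimage_of_relIndex_ne_zero (isClosed_conj_smul hA _) hg.1
  exact mem_of_forall_mem_mul hA hKA fun U hUo hUn hKU => h U hUo hUn hKU g (isOpen_preimage_inf hrel U)

end Profinite

variable (G : PSCDatum P)

/-! ## 2. P12-L02: Prop. 1.2 (i) AT EVERY LEVEL from the separating coverings

For an open normal `U ⊴ Π_G` (a finite étale Galois covering `G_U → G`), the vertex of `G_U` over `v`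
through `γ` is the double coset `U γ Π_v`, with decomposition group `U ∩ γΠ_vγ⁻¹`; two such vertices
`(v₁, Uγ₁Π_{v₁})`, `(v₂, Uγ₂Π_{v₂})` whose decomposition groups meet in a relatively open subgroup of
the first ARE THE SAME VERTEX (`v₁ = v₂` and `γ₂ ∈ U γ₁ Π_{v₁}`).  This is the shape of [SemiAnbd]
Prop. 2.6 ("the proof of assertion (i) is entirely similar to the proof of [Mzk7], Proposition 2.6"). -/

section LevelwiseI

variable [IsTopologicalGroup P] [CompactSpace P] [TotallyDisconnectedSpace P]

/-- **Prop. 1.2 (i) at level `U`, verticial case**, from `VerticialSeparatingCoverings`: shrink to an open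
normal `U₁` with `U₁ ∩ (U ∩ γ₁Π_{v₁}γ₁⁻¹) ≤ γ₂Π_{v₂}γ₂⁻¹`, descend to the level `V' ≤ U ∩ U₁` supplied by
the statement; if the two level-`V'` vertices were distinct, the separating covering `U'` would contain
`γ₂Π_{v₂}γ₂⁻¹ ∩ V' ⊇ γ₁Π_{v₁}γ₁⁻¹ ∩ V'` — contradiction. [cite: MochizukiCombGC2007, Prop 1.2(i) p.9] -/
theorem sameVertex_of_isOpen (hsep : G.VerticialSeparatingCoverings) (U : Subgroup P)
    (hUo : IsOpen (U : Set P)) [hUn : U.Normal] (v₁ v₂ : G.graph.V) (γ₁ γ₂ : ConjAct P)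
    (h : IsOpen (((↑) : ↥(U ⊓ γ₁ • G.vertGp v₁) → P) ⁻¹' ((γ₂ • G.vertGp v₂ : Subgroup P) : Set P))) :
    v₁ = v₂ ∧ ConjAct.ofConjAct γ₂ ∈
      DoubleCoset.doubleCoset (ConjAct.ofConjAct γ₁) (U : Set P) (G.vertGp v₁ : Set P) := by
  by_contra hne
  obtain ⟨U₁, hU₁o, hU₁n, -, hU₁⟩ :=
    exists_openNormal_inf_le (K := ⊥) (A₂ := γ₂ • G.vertGp v₂) bot_le bot_le h
  obtain ⟨V', hV'n, hV'o, hV'le, hsepV⟩ := hsep (U ⊓ U₁) inferInstance (hUo.inter hU₁o)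
  have hdist : v₁ ≠ v₂ ∨
      DoubleCoset.doubleCoset (ConjAct.ofConjAct γ₁) (V' : Set P) (G.vertGp v₁ : Set P) ≠
        DoubleCoset.doubleCoset (ConjAct.ofConjAct γ₂) (V' : Set P) (G.vertGp v₂ : Set P) := by
    by_contra hcon
    push Not at hcon
    obtain ⟨rfl, hdc⟩ := hcon
    refine hne ⟨rfl, doubleCoset_mono (hV'le.trans inf_le_left) _ _ ?_⟩
    rw [hdc]
    exact DoubleCoset.mem_doubleCoset_self V' (G.vertGp v₁) _
  obtain ⟨U', -, -, -, htriv, hnon⟩ := hsepV v₁ v₂ γ₁ γ₂ hdist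
  apply hnon
  intro x hx
  obtain ⟨hxA, hxV'⟩ := Subgroup.mem_inf.mp hx
  have hxU : x ∈ U := (inf_le_left : U ⊓ U₁ ≤ U) (hV'le hxV')
  have hxU₁ : x ∈ U₁ := (inf_le_right : U ⊓ U₁ ≤ U₁) (hV'le hxV')
  have hx₂ : x ∈ γ₂ • G.vertGp v₂ :=
    hU₁ (Subgroup.mem_inf.mpr ⟨hxU₁, Subgroup.mem_inf.mpr ⟨hxU, hxA⟩⟩)
  exact htriv (Subgroup.mem_inf.mpr ⟨hx₂, hxV'⟩)

/-- **Prop. 1.2 (i) at level `U`, edge-like case**, from `EdgeLikeSeparatingCoverings`.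
[cite: MochizukiCombGC2007, Prop 1.2(i) p.9] -/
theorem sameEdge_of_isOpen (hsep : G.EdgeLikeSeparatingCoverings) (U : Subgroup P)
    (hUo : IsOpen (U : Set P)) [hUn : U.Normal] (e₁ e₂ : G.graph.N ⊕ G.graph.C) (γ₁ γ₂ : ConjAct P)
    (h : IsOpen (((↑) : ↥(U ⊓ γ₁ • G.edgeGp e₁) → P) ⁻¹' ((γ₂ • G.edgeGp e₂ : Subgroup P) : Set P))) :
    e₁ = e₂ ∧ ConjAct.ofConjAct γ₂ ∈
      DoubleCoset.doubleCoset (ConjAct.ofConjAct γ₁) (U : Set P) (G.edgeGp e₁ : Set P) := by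
  by_contra hne
  obtain ⟨U₁, hU₁o, hU₁n, -, hU₁⟩ :=
    exists_openNormal_inf_le (K := ⊥) (A₂ := γ₂ • G.edgeGp e₂) bot_le bot_le h
  obtain ⟨V', hV'n, hV'o, hV'le, hsepV⟩ := hsep (U ⊓ U₁) inferInstance (hUo.inter hU₁o)
  have hdist : e₁ ≠ e₂ ∨
      DoubleCoset.doubleCoset (ConjAct.ofConjAct γ₁) (V' : Set P) (G.edgeGp e₁ : Set P) ≠
        DoubleCoset.doubleCoset (ConjAct.ofConjAct γ₂) (V' : Set P) (G.edgeGp e₂ : Set P) := by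
    by_contra hcon
    push Not at hcon
    obtain ⟨rfl, hdc⟩ := hcon
    refine hne ⟨rfl, doubleCoset_mono (hV'le.trans inf_le_left) _ _ ?_⟩
    rw [hdc]
    exact DoubleCoset.mem_doubleCoset_self V' (G.edgeGp e₁) _
  obtain ⟨U', -, -, -, htriv, hnon⟩ := hsepV e₁ e₂ γ₁ γ₂ hdist
  apply hnon
  intro x hx
  obtain ⟨hxA, hxV'⟩ := Subgroup.mem_inf.mp hx
  have hxU : x ∈ U := (inf_le_left : U ⊓ U₁ ≤ U) (hV'le hxV')
  have hxU₁ : x ∈ U₁ := (inf_le_right : U ⊓ U₁ ≤ U₁) (hV'le hxV')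
  have hx₂ : x ∈ γ₂ • G.edgeGp e₂ :=
    hU₁ (Subgroup.mem_inf.mpr ⟨hxU₁, Subgroup.mem_inf.mpr ⟨hxU, hxA⟩⟩)
  exact htriv (Subgroup.mem_inf.mpr ⟨hx₂, hxV'⟩)

/-- **Prop. 1.2 (i) at the `Π^unr_G`-level `U ⊇ Ker(Π_G ↠ Π^unr_G)`, unramified verticial case (`G`
sturdy)**, from `UnrVerticialSeparatingCoverings`: if the unramified decomposition groups
`B̃ᵢ = (U ∩ γᵢΠ_{vᵢ}γᵢ⁻¹)·Ker = U ∩ (γᵢΠ_{vᵢ}γᵢ⁻¹·Ker)` meet in a relatively open subgroup of `B̃₁`, the two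
vertices of `G_U` coincide.  The shrinking keeps `Ker` inside the level. [cite: MochizukiCombGC2007, Prop 1.2(i) p.9] -/
theorem sameVertex_of_isOpen_unr (hsep : G.UnrVerticialSeparatingCoverings) (hst : G.IsSturdy)
    (U : Subgroup P) (hUo : IsOpen (U : Set P)) [hUn : U.Normal] (hKU : G.unrKer ≤ U)
    (v₁ v₂ : G.graph.V) (γ₁ γ₂ : ConjAct P)
    (h : IsOpen (((↑) : ↥(U ⊓ (γ₁ • G.vertGp v₁ ⊔ G.unrKer)) → P) ⁻¹'
      ((γ₂ • G.vertGp v₂ ⊔ G.unrKer : Subgroup P) : Set P))) :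
    v₁ = v₂ ∧ ConjAct.ofConjAct γ₂ ∈
      DoubleCoset.doubleCoset (ConjAct.ofConjAct γ₁) (U : Set P) (G.vertGp v₁ : Set P) := by
  by_contra hne
  obtain ⟨U₁, hU₁o, hU₁n, hKU₁, hU₁⟩ :=
    exists_openNormal_inf_le (K := G.unrKer) (A₂ := γ₂ • G.vertGp v₂ ⊔ G.unrKer)
      (le_inf hKU le_sup_right) le_sup_right h
  obtain ⟨V', hV'n, hV'o, hV'le, hsepV⟩ := hsep hst (U ⊓ U₁) inferInstance (hUo.inter hU₁o)
  have hV'U : V' ≤ U := hV'le.trans inf_le_left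
  have hdist : v₁ ≠ v₂ ∨
      DoubleCoset.doubleCoset (ConjAct.ofConjAct γ₁) (V' : Set P)
          ((G.vertGp v₁ ⊔ G.unrKer : Subgroup P) : Set P) ≠
        DoubleCoset.doubleCoset (ConjAct.ofConjAct γ₂) (V' : Set P)
          ((G.vertGp v₂ ⊔ G.unrKer : Subgroup P) : Set P) := by
    by_contra hcon
    push Not at hcon
    obtain ⟨rfl, hdc⟩ := hcon
    -- `γ₂ ∈ V' γ₁ (Π_{v₁}·Ker) = (V'·Ker) γ₁ Π_{v₁} ⊆ U γ₁ Π_{v₁}`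
    have hmem : ConjAct.ofConjAct γ₂ ∈ DoubleCoset.doubleCoset (ConjAct.ofConjAct γ₁) (V' : Set P)
        ((G.vertGp v₁ ⊔ G.unrKer : Subgroup P) : Set P) := by
      rw [hdc]
      exact DoubleCoset.mem_doubleCoset_self V' (G.vertGp v₁ ⊔ G.unrKer) _
    refine hne ⟨rfl, ?_⟩
    obtain ⟨u, hu, b, hb, heq⟩ := DoubleCoset.mem_doubleCoset.mp hmem
    have hb' : b ∈ ((G.vertGp v₁ ⊔ G.unrKer : Subgroup P) : Set P) := hb
    rw [Subgroup.mul_normal] at hb'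
    obtain ⟨a, ha, k, hk, rfl⟩ := Set.mem_mul.mp hb'
    -- `γ₂ = u γ₁ a k = (u · (γ₁ a) k (γ₁ a)⁻¹) · γ₁ · a` with the conjugate of `k` in `Ker ≤ U`
    refine DoubleCoset.mem_doubleCoset.mpr
      ⟨u * ((ConjAct.ofConjAct γ₁ * a) * k * (ConjAct.ofConjAct γ₁ * a)⁻¹), ?_, a, ha, ?_⟩
    · refine U.mul_mem (hV'U hu) (hKU ?_)
      exact (inferInstance : G.unrKer.Normal).conj_mem k hk _
    · rw [heq]
      group
  obtain ⟨U', -, -, -, htriv, hnon⟩ := hsepV v₁ v₂ γ₁ γ₂ hdist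
  apply hnon
  intro x hx
  obtain ⟨hxA, hxV'⟩ := Subgroup.mem_inf.mp hx
  have hxU : x ∈ U := hV'U hxV'
  have hxU₁ : x ∈ U₁ := (inf_le_right : U ⊓ U₁ ≤ U₁) (hV'le hxV')
  have hx₁ : x ∈ U ⊓ (γ₁ • G.vertGp v₁ ⊔ G.unrKer) :=
    Subgroup.mem_inf.mpr ⟨hxU, (le_sup_left : γ₁ • G.vertGp v₁ ≤ _) hxA⟩
  have hx₂ : x ∈ γ₂ • G.vertGp v₂ ⊔ G.unrKer := hU₁ (Subgroup.mem_inf.mpr ⟨hxU₁, hx₁⟩)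
  exact htriv (Subgroup.mem_inf.mpr ⟨hx₂, hxV'⟩)

end LevelwiseI

/-! ## 3. P12-L02: Prop. 1.2 (i) as typed (the level `U = Π_G`) -/

section L02

variable [IsTopologicalGroup P] [CompactSpace P] [TotallyDisconnectedSpace P]

/-- **[CombGC] Prop. 1.2 (i), verticial case, from the separating coverings** (row P12-L02-V): "If
`A₁ ∩ A₂` is open in `A₁`, then `v₁ = v₂`". [cite: MochizukiCombGC2007, Prop 1.2(i) p.8] -/
theorem verticialOpenInterDeterminesVertex_of_separating (hsep : G.VerticialSeparatingCoverings) :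
    G.VerticialOpenInterDeterminesVertex := by
  intro v₁ v₂ γ₁ γ₂ h
  rw [coe_inf_subgroupOf] at h
  have htop : IsOpen ((⊤ : Subgroup P) : Set P) := by simp
  exact (G.sameVertex_of_isOpen hsep ⊤ htop v₁ v₂ γ₁ γ₂
    (isOpen_preimage_of_eq (top_inf_eq _).symm h)).1

/-- **[CombGC] Prop. 1.2 (i), edge-like case, from the separating coverings** (row P12-L02-E):
"(respectively, `e₁ = e₂`)". [cite: MochizukiCombGC2007, Prop 1.2(i) p.8] -/
theorem edgeLikeOpenInterDeterminesEdge_of_separating (hsep : G.EdgeLikeSeparatingCoverings) :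
    G.EdgeLikeOpenInterDeterminesEdge := by
  intro e₁ e₂ γ₁ γ₂ h
  rw [coe_inf_subgroupOf] at h
  have htop : IsOpen ((⊤ : Subgroup P) : Set P) := by simp
  exact (G.sameEdge_of_isOpen hsep ⊤ htop e₁ e₂ γ₁ γ₂
    (isOpen_preimage_of_eq (top_inf_eq _).symm h)).1

/-- **[CombGC] Prop. 1.2 (i), unramified verticial case (`G` sturdy), from the separating
`Π^unr`-coverings** (row P12-L02-U): "if `B₁ ∩ B₂` is open in `B₁`, then `v₁ = v₂`".
[cite: MochizukiCombGC2007, Prop 1.2(i) p.8] -/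
theorem unrVerticialOpenInterDeterminesVertex_of_separating (hsep : G.UnrVerticialSeparatingCoverings) :
    G.UnrVerticialOpenInterDeterminesVertex := by
  intro hst v₁ v₂ γ₁ γ₂ h
  rw [coe_inf_subgroupOf] at h
  have htop : IsOpen ((⊤ : Subgroup P) : Set P) := by simp
  exact (G.sameVertex_of_isOpen_unr hsep hst ⊤ htop le_top v₁ v₂ γ₁ γ₂
    (isOpen_preimage_of_eq (top_inf_eq _).symm h)).1

end L02

end PSCDatum

end Literature.AnabelianGeometry.SemiGraphs

end
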